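import Literature.Computability.AlgebraicComplexity.BI17MinimalDegreeNearSquares
import Literature.NumberTheory.DiophantineGeometry.KroneckerSemigroup
import HarnessLib

/-!
# Bürgisser–Ikenmeyer 2017, Ex. 5.6: mixed-format splitting of the rectangular Kronecker coefficients `k_m(δ)`

P. Bürgisser, C. Ikenmeyer, *Fundamental invariants of orbit closures*, J. Algebra **477** (2017)
390–434 = arXiv:1511.02927 [BurgisserIkenmeyer2017], §5, Ex. 5.6 (held text
`paper:arxiv-1511.02927` p0018): "`E'(10) = E'(11) = E'(12) = {0,4,5,6,7,…}`" — in print a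
computation with the DERKSEN program; `E'(m) = {δ | k_m(δ) > 0}` (eq. (5.2)),
`k_m(δ) = k(m×δ, m×δ, m×δ)` the Kronecker coefficient of three rectangles `m × δ = (δ,…,δ)`.

THEOREM-ONLY file (no definition, no named fact) towards the named fact `BI2017_ex_5_6` of
`BI17FundamentalInvariantTensors.lean` (val-lit row BI2017-B), whose one open clause is the shape
`E(m) = {0} ∪ (e(m) + mℕ)` for `7 ≤ m ≤ 12` (`BI2017_ex_5_6_of_shape`,
`BI17KronRectComplementSymmetry.lean`). Main content:

* `kronRect_pos_of_pieces` / `kronRect_pos_of_split` (ours; elementary from two tree theorems;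
  found simultaneously by val-lit t08 g6, t10 g7 and t04 g6, 2026-08-27): **if `a + a' = m`,
  `c + c' = δ` (so `δa = mc`) and the two MIXED-FORMAT rectangular Kronecker coefficients
  `g((a^δ), (a^δ), (c^m))`, `g((a'^δ), (a'^δ), (c'^m))` are positive, then `k_m(δ) > 0`**
  (`(x^y)` = `y` rows of length `x` = `Nat.Partition.rectangle y x`). Proof:
  `k(m×δ, m×δ, m×δ) = k((m×δ)ᵀ, (m×δ)ᵀ, m×δ)` (`kroneckerCoeff_transpose₁₂`; BI §5.1, proof of
  Thm. 5.9 (1): "The symmetry property of Kronecker coefficients allows to transpose two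
  partitions"), `(m×δ)ᵀ = δ×m = δ×a + δ×a'` and `m×δ = m×c + m×c'` row-wise, and the semigroup
  property `kroneckerCoeff_pos_of_ofPartition_add` (Ex. 5.5: "`k(λ,μ,ν) ≤ k(λ+λ̄, μ+μ̄, ν+ν̄)` if
  `k(λ̄,μ̄,ν̄) > 0`"). A non-trivial splitting exists iff `gcd(m, δ) > 1` (the piece sizes `δa = mc`
  are common multiples of `m` and `δ` below `mδ`); it replaces a class sum in `S_{mδ}` by class
  sums in `S_{δa}` and `S_{δa'}`, and it may be iterated on the pieces.
* two reductions inside Ex. 5.6's table, with the class sums written for the tree's verified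
  Murnaghan–Nakayama evaluator `MNEval.kronSum` (`kroneckerCoeff_pos_iff_kronSum_pos`):
  `kronRect_ten_five_pos_of_kronSum` (`k_10(5) > 0 ⇐ g((4^5),(4^5),(2^10)) > 0 ∧ g((6^5),(6^5),(3^10)) > 0`,
  the `S_20` piece PROVED here by one kernel `decide`, `Mixed.kronSum_twenty_pos`; it is also an
  instance of Ikenmeyer–Panova 2017 Cor. 6.10) and `kronRect_ten_six_pos_of_kronSum`
  (`k_10(6) > 0 ⇐ g((5^6),(5^6),(3^10)) > 0`, the same `S_30` number `5` after `transpose₁₂`); the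
  `S_30` piece is left to a kernel certificate of a sibling file (val-lit t10 g7). The atoms
  `k_8(4)` (`⇐ g((4^4),(4^4),(2^8)) = 1`, twice) and `k_12(6)` (`⇐ g((4^6),(4^6),(2^12)) = 1`, three
  times) fall to ITERATED splittings with two-column pieces that are tree theorems
  (Ikenmeyer–Panova Cor. 6.10 / Sylvester; observed by val-lit t04 g6 and t10 g7) — not typed here;
* `k_7(7) > 0` is the tree's `kronRect_self_pos`; the shape clause of Ex. 5.6 at each
  `m ∈ {7, …, 12}` from its remaining ATOMS (`BI2017_ex_5_6_shape_seven_of`, …, `_twelve_of`, via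
  `genericTensorDegreeMonoid_shape_of_atoms` and the degree monoid `kronRect_add_pos`), and the
  assembly `BI2017_ex_5_6_of_atoms`: **`BI2017_ex_5_6` follows from the fourteen positivities
  `k_7(5), k_7(6), k_8(4), k_8(5), k_9(5), k_10(5), k_10(6), k_10(7), k_11(5), k_11(6), k_11(7),
  k_12(5), k_12(6), k_12(7) > 0`** (all printed in Ex. 5.6 as DERKSEN computations). Of these,
  `k_8(4), k_10(5), k_10(6), k_12(6)` are reachable by the splitting (class sums in `S_16 … S_30`);
  the ten COPRIME atoms `k_7(5), k_7(6), k_8(5), k_9(5), k_10(7), k_11(5), k_11(6), k_11(7), k_12(5),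
  k_12(7)` (Kronecker coefficients in `S_35 … S_84`) admit no splitting, and no single clause
  `m ∈ {7, …, 12}` closes without one of them: the named fact stays OPEN.

Honest framing: typed-literature bookkeeping for the cell `val-lit` (LADDER-VALIANT V3, a
known-results layer); nothing here bears on VP versus VNP.

## References
* [BurgisserIkenmeyer2017] §5 eq. (5.2), Ex. 5.5 (monotonicity / semigroup remark), Ex. 5.6,
  proof of Thm. 5.9 (1) (transposing two partitions).
* [IkenmeyerPanova2017] C. Ikenmeyer, G. Panova, Adv. Math. 319 (2017), §1.1 (semigroup property).
* [FultonHarrisGTM129] Exercise 4.51 (the character formula behind `MNEval.kronSum`).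

## Mathlib and tree
Tree: `kronRect`, `BI2017_ex_5_6` (`BI17FundamentalInvariantTensors`); `kroneckerCoeff_transpose₁₂`
(`SymmetricGroupRepsSignTwist`); `kroneckerCoeff_pos_of_ofPartition_add` (`KroneckerSemigroup`);
`parts_transpose_rectangle` (`BLMW11StanleyRectangularCharacterProofs`); `Weight.ofPartition`,
`Nat.Partition.sortedParts_rectangle`, `Nat.Partition.card_parts_rectangle_le`;
`MNEval.kroneckerCoeff_pos_iff_kronSum_pos`; values `kronRect_seven_four_pos`, `kronRect_self_pos`,
`kronRect_eight_three`, `kronRect_nine_four`, `kronRect_ten_four`, `kronRect_eleven_four`,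
`kronRect_twelve_four`, `kronRect_seven_three`, `kronRect_eq_zero_of_sq_lt`, `kronRect_add_pos`,
`genericTensorDegreeMonoid_shape_of_atoms`, `BI2017_ex_5_6_of_shape`, `BI2017_ex_5_6_ten/…/twelve`
(`BI17Ex56SmallCases`, `BI17KronRectComplementSymmetry`).

Provenance: val-lit cell, literature-prover val-lit-t08 g6 (programme #8 hand, lead-bip RULINGS #50 (3)).
-/

open _root_.Literature.NumberTheory.DiophantineGeometry
open _root_.Literature.RepresentationTheory.FiniteGroups.MNEval

namespace Literature.Computability.AlgebraicComplexity

/-! ### 1. The splitting lemma -/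

section Splitting

/-- The weight of a partition depends only on its multiset of parts (transport across the size
index). [folklore] -/
private theorem ofPartition_eq_of_parts_eq {n n' N : ℕ} {p : Nat.Partition n} {q : Nat.Partition n'}
    (h : p.parts = q.parts) : Weight.ofPartition N p = Weight.ofPartition N q := by
  obtain rfl : n = n' := by rw [← p.parts_sum, h, q.parts_sum]
  obtain rfl : p = q := Nat.Partition.ext h
  rfl

/-- The sorted parts of a partition depend only on its multiset of parts. [folklore] -/
private theorem sortedParts_eq_of_parts_eq {n n' : ℕ} {p : Nat.Partition n} {q : Nat.Partition n'}
    (h : p.parts = q.parts) : p.sortedParts = q.sortedParts := by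
  obtain rfl : n = n' := by rw [← p.parts_sum, h, q.parts_sum]
  obtain rfl : p = q := Nat.Partition.ext h
  rfl

/-- Row-wise additivity of rectangle weights: `wt(k × (b + b')) = wt(k × b) + wt(k × b')`.
[cite: IkenmeyerPanova2017, §1.1] -/
private theorem ofPartition_rectangle_add (N k b b' : ℕ) :
    Weight.ofPartition N (Nat.Partition.rectangle k (b + b')) =
      Weight.ofPartition N (Nat.Partition.rectangle k b) +
        Weight.ofPartition N (Nat.Partition.rectangle k b') := by
  rw [ofPartition_rectangle_eq, ofPartition_rectangle_eq, ofPartition_rectangle_eq]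
  funext i
  simp only [Pi.add_apply]
  split_ifs
  · push_cast
    ring
  · simp

/-- **Mixed-format splitting of `k_m(δ)`, Kronecker-coefficient form** (ours): if `a + a' = m`,
`c + c' = δ`, and `g(λ, μ, ν) > 0`, `g(λ', μ', ν') > 0` for partitions with the parts of
`(a^δ), (a^δ), (c^m)` and of `(a'^δ), (a'^δ), (c'^m)` (any size indices), then `k_m(δ) > 0`:
transpose two of the three rectangles `m × δ` to `δ × m` (`kroneckerCoeff_transpose₁₂`), split
`δ × m = δ × a + δ × a'` and `m × δ = m × c + m × c'` row-wise, and apply the semigroup property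
(`kroneckerCoeff_pos_of_ofPartition_add`). [cite: BurgisserIkenmeyer2017, Ex. 5.5 and proof of Thm. 5.9 (1)] -/
theorem kronRect_pos_of_pieces {m δ a a' c c' n n' : ℕ} (ha : a + a' = m) (hc : c + c' = δ)
    {lam mu nu : Nat.Partition n} {lam' mu' nu' : Nat.Partition n'}
    (hlam : lam.parts = (Nat.Partition.rectangle δ a).parts)
    (hmu : mu.parts = (Nat.Partition.rectangle δ a).parts)
    (hnu : nu.parts = (Nat.Partition.rectangle m c).parts)
    (hlam' : lam'.parts = (Nat.Partition.rectangle δ a').parts)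
    (hmu' : mu'.parts = (Nat.Partition.rectangle δ a').parts)
    (hnu' : nu'.parts = (Nat.Partition.rectangle m c').parts)
    (h₁ : 0 < kroneckerCoeff ℂ lam mu nu) (h₂ : 0 < kroneckerCoeff ℂ lam' mu' nu') :
    0 < kronRect ℂ m δ := by
  obtain rfl : n = δ * a := by
    rw [← lam.parts_sum, hlam, (Nat.Partition.rectangle δ a).parts_sum]
  obtain rfl : n' = δ * a' := by
    rw [← lam'.parts_sum, hlam', (Nat.Partition.rectangle δ a').parts_sum]
  -- the targets as partitions of `δa + δa'`
  have hsize : δ * a + δ * a' = m * δ := by rw [← mul_add, ha, mul_comm]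
  let Lam : Nat.Partition (δ * a + δ * a') :=
    ⟨(Nat.Partition.rectangle δ m).parts, fun hi => (Nat.Partition.rectangle δ m).parts_pos hi,
      by rw [(Nat.Partition.rectangle δ m).parts_sum, ← mul_add, ha]⟩
  let Nu : Nat.Partition (δ * a + δ * a') :=
    ⟨(Nat.Partition.rectangle m δ).parts, fun hi => (Nat.Partition.rectangle m δ).parts_pos hi,
      by rw [(Nat.Partition.rectangle m δ).parts_sum, hsize]⟩
  have hLam : Lam.parts = (Nat.Partition.rectangle δ m).parts := rfl
  have hNu : Nu.parts = (Nat.Partition.rectangle m δ).parts := rfl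
  -- semigroup
  have hpos : 0 < kroneckerCoeff ℂ Lam Lam Nu := by
    refine kroneckerCoeff_pos_of_ofPartition_add (m + δ)
      ((hlam ▸ Nat.Partition.card_parts_rectangle_le δ a).trans (by omega))
      ((hmu ▸ Nat.Partition.card_parts_rectangle_le δ a).trans (by omega))
      ((hnu ▸ Nat.Partition.card_parts_rectangle_le m c).trans (by omega))
      ((hlam' ▸ Nat.Partition.card_parts_rectangle_le δ a').trans (by omega))
      ((hmu' ▸ Nat.Partition.card_parts_rectangle_le δ a').trans (by omega))
      ((hnu' ▸ Nat.Partition.card_parts_rectangle_le m c').trans (by omega))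
      ((hLam ▸ Nat.Partition.card_parts_rectangle_le δ m).trans (by omega))
      ((hLam ▸ Nat.Partition.card_parts_rectangle_le δ m).trans (by omega))
      ((hNu ▸ Nat.Partition.card_parts_rectangle_le m δ).trans (by omega))
      ?_ ?_ ?_ h₁ h₂
    · rw [ofPartition_eq_of_parts_eq hLam, ofPartition_eq_of_parts_eq hlam,
        ofPartition_eq_of_parts_eq hlam', ← ha, ofPartition_rectangle_add]
    · rw [ofPartition_eq_of_parts_eq hLam, ofPartition_eq_of_parts_eq hmu,
        ofPartition_eq_of_parts_eq hmu', ← ha, ofPartition_rectangle_add]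
    · rw [ofPartition_eq_of_parts_eq hNu, ofPartition_eq_of_parts_eq hnu,
        ofPartition_eq_of_parts_eq hnu', ← ofPartition_rectangle_add, hc]
  -- transpose two slots back to `m × δ`
  unfold kronRect
  rw [kroneckerCoeff_transpose₁₂]
  rwa [kroneckerCoeff_eq_of_parts_eq (a' := Lam) (b' := Lam) (c' := Nu)
    ((parts_transpose_rectangle m δ).trans hLam.symm) ((parts_transpose_rectangle m δ).trans hLam.symm)
    hNu.symm]

/-- **Mixed-format splitting of `k_m(δ)`, class-sum form** (ours): if `a + a' = m`, `c + c' = δ`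
with all four positive, `δa = mc`, and the class sums `(δa)!·g((a^δ),(a^δ),(c^m))` and
`(δa')!·g((a'^δ),(a'^δ),(c'^m))` (the tree's verified Murnaghan–Nakayama evaluator `MNEval.kronSum`)
are positive, then `k_m(δ) > 0`. [cite: BurgisserIkenmeyer2017, Ex. 5.5 and proof of Thm. 5.9 (1)] -/
theorem kronRect_pos_of_split {m δ a a' c c' : ℕ} (ha : a + a' = m) (hc : c + c' = δ)
    (h0a : 0 < a) (h0a' : 0 < a') (h0c : 0 < c) (h0c' : 0 < c') (hac : δ * a = m * c)
    (h₁ : 0 < kronSum (δ * a) (List.replicate δ a) (List.replicate δ a) (List.replicate m c))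
    (h₂ : 0 < kronSum (δ * a') (List.replicate δ a') (List.replicate δ a') (List.replicate m c')) :
    0 < kronRect ℂ m δ := by
  have hac' : δ * a' = m * c' := by
    have h : δ * a + δ * a' = m * c + m * c' := by
      rw [← mul_add, ha, ← mul_add, hc, mul_comm]
    rw [hac] at h
    exact Nat.add_left_cancel h
  -- the third pieces as partitions of `δa` and `δa'`
  let nu : Nat.Partition (δ * a) :=
    ⟨(Nat.Partition.rectangle m c).parts, fun hi => (Nat.Partition.rectangle m c).parts_pos hi,
      by rw [(Nat.Partition.rectangle m c).parts_sum, hac]⟩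
  let nu' : Nat.Partition (δ * a') :=
    ⟨(Nat.Partition.rectangle m c').parts, fun hi => (Nat.Partition.rectangle m c').parts_pos hi,
      by rw [(Nat.Partition.rectangle m c').parts_sum, hac']⟩
  have hnu : nu.parts = (Nat.Partition.rectangle m c).parts := rfl
  have hnu' : nu'.parts = (Nat.Partition.rectangle m c').parts := rfl
  refine kronRect_pos_of_pieces ha hc rfl rfl hnu rfl rfl hnu' ?_ ?_
  · rw [kroneckerCoeff_pos_iff_kronSum_pos, Nat.Partition.sortedParts_rectangle δ a h0a.ne',
      sortedParts_eq_of_parts_eq hnu, Nat.Partition.sortedParts_rectangle m c h0c.ne']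
    exact h₁
  · rw [kroneckerCoeff_pos_iff_kronSum_pos, Nat.Partition.sortedParts_rectangle δ a' h0a'.ne',
      sortedParts_eq_of_parts_eq hnu', Nat.Partition.sortedParts_rectangle m c' h0c'.ne']
    exact h₂

/-- **Symmetric splitting** (the case `a = a'`, `c = c'`): if `m = 2a`, `δ = 2c`, `δa = mc` and
`(δa)!·g((a^δ),(a^δ),(c^m)) > 0`, then `k_m(δ) > 0`. [cite: BurgisserIkenmeyer2017, Ex. 5.5 and proof of Thm. 5.9 (1)] -/
theorem kronRect_pos_of_split_self {m δ a c : ℕ} (ha : a + a = m) (hc : c + c = δ)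
    (h0a : 0 < a) (h0c : 0 < c) (hac : δ * a = m * c)
    (h : 0 < kronSum (δ * a) (List.replicate δ a) (List.replicate δ a) (List.replicate m c)) :
    0 < kronRect ℂ m δ :=
  kronRect_pos_of_split ha hc h0a h0a h0c h0c hac h h

end Splitting

/-! ### 2. The `S_20` piece and the three reductions inside Ex. 5.6's table -/

namespace Mixed

/-- **`g((4^5),(4^5),(2^10)) > 0`** (its value is `1`): the class sum `20!·g` over the `627` classes
of `S_20`, one kernel `decide`. [cite: BurgisserIkenmeyer2017, Ex. 5.6] -/
theorem kronSum_twenty_pos :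
    0 < kronSum (5 * 4) (List.replicate 5 4) (List.replicate 5 4) (List.replicate 10 2) := by
  show 0 < kronSum 20 [4, 4, 4, 4, 4] [4, 4, 4, 4, 4] [2, 2, 2, 2, 2, 2, 2, 2, 2, 2]
  set_option maxHeartbeats 100000000 in
  set_option maxRecDepth 100000 in
  decide +kernel

end Mixed

/-- **`k_10(5) > 0` ("`5 ∈ E'(10)`") from two mixed pieces**: `10 = 4 + 6`, `5 = 2 + 3`,
`5·4 = 10·2`; the `S_20` piece is `Mixed.kronSum_twenty_pos`, the `S_30` piece
`g((6^5),(6^5),(3^10)) > 0` is the hypothesis (a kernel certificate of a sibling file).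
[cite: BurgisserIkenmeyer2017, Ex. 5.6] -/
theorem kronRect_ten_five_pos_of_kronSum
    (h30 : 0 < kronSum (5 * 6) (List.replicate 5 6) (List.replicate 5 6) (List.replicate 10 3)) :
    0 < kronRect ℂ 10 5 :=
  kronRect_pos_of_split (a := 4) (a' := 6) (c := 2) (c' := 3) rfl rfl (by norm_num) (by norm_num)
    (by norm_num) (by norm_num) rfl Mixed.kronSum_twenty_pos h30

/-- **`k_10(6) > 0` ("`6 ∈ E'(10)`") from one mixed piece**: `10 = 5 + 5`, `6 = 3 + 3`,
`6·5 = 10·3`; the `S_30` piece `g((5^6),(5^6),(3^10)) > 0` is the hypothesis.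
[cite: BurgisserIkenmeyer2017, Ex. 5.6] -/
theorem kronRect_ten_six_pos_of_kronSum
    (h30 : 0 < kronSum (6 * 5) (List.replicate 6 5) (List.replicate 6 5) (List.replicate 10 3)) :
    0 < kronRect ℂ 10 6 :=
  kronRect_pos_of_split_self (a := 5) (c := 3) rfl rfl (by norm_num) (by norm_num) rfl h30

/-! ### 3. The shape clause of Ex. 5.6 at `m = 7, …, 12` from atoms -/

section Shape

/-- Monoid generation: if `k_m(δ) > 0` for all `δ₀ ≤ δ < 2δ₀` (`δ₀ ≥ 1`, `m ≥ 1`), then `k_m(δ) > 0`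
for all `δ ≥ δ₀`. [cite: BurgisserIkenmeyer2017, §5 eq. (5.1)–(5.2)] -/
theorem kronRect_pos_of_window {m δ₀ : ℕ} (hm : 0 < m) (h0 : 0 < δ₀)
    (hwin : ∀ δ : ℕ, δ₀ ≤ δ → δ < 2 * δ₀ → 0 < kronRect ℂ m δ) :
    ∀ δ : ℕ, δ₀ ≤ δ → 0 < kronRect ℂ m δ := by
  intro δ
  induction δ using Nat.strong_induction_on with
  | _ δ ih =>
    intro hδ
    by_cases hlt : δ < 2 * δ₀
    · exact hwin δ hδ hlt
    · have e : δ = (δ - δ₀) + δ₀ := by omega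
      rw [e]
      exact kronRect_add_pos hm (ih (δ - δ₀) (by omega) (by omega)) (hwin δ₀ le_rfl (by omega))

/-- **Ex. 5.6 shape at `m = 7` from atoms**: `E(7) = {0} ∪ (28 + 7ℕ)` ("`E'(7) = {0,4,5,6,7,8,…}`")
follows from `k_7(5) > 0` and `k_7(6) > 0` (`k_7(4) = 14`, `k_7(7) > 0`, `k_7(3) = 0` are tree
theorems). [cite: BurgisserIkenmeyer2017, Ex. 5.6] -/
theorem BI2017_ex_5_6_shape_seven_of (h5 : 0 < kronRect ℂ 7 5) (h6 : 0 < kronRect ℂ 7 6) :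
    genericTensorDegreeMonoid (Fin 7) ℂ =
      {d | d = 0 ∨ ∃ δ : ℕ, d = 7 * δ ∧ genericTensorMinimalDegree (Fin 7) ℂ ≤ 7 * δ} := by
  refine genericTensorDegreeMonoid_shape_of_atoms (δ₀ := 4) (by norm_num)
    (BI2017_ex_5_6_seven.trans (by norm_num))
    (kronRect_pos_of_window (by norm_num) (by norm_num) fun δ h1 h2 => ?_)
    (fun δ hδ hlt => ?_)
  · interval_cases δ
    · exact kronRect_seven_four_pos
    · exact h5
    · exact h6
    · exact kronRect_self_pos 7 (by norm_num)
  · interval_cases δ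
    · exact kronRect_eq_zero_of_sq_lt ℂ one_pos (by norm_num)
    · exact kronRect_eq_zero_of_sq_lt ℂ two_pos (by norm_num)
    · exact kronRect_seven_three

/-- **Ex. 5.6 shape at `m = 8` from atoms**: `E(8) = {0} ∪ (24 + 8ℕ)` ("`E'(8) = {0,3,4,5,6,…}`")
follows from `k_8(4) > 0` and `k_8(5) > 0` (`k_8(3) = 1` is a tree theorem).
[cite: BurgisserIkenmeyer2017, Ex. 5.6] -/
theorem BI2017_ex_5_6_shape_eight_of (h4 : 0 < kronRect ℂ 8 4) (h5 : 0 < kronRect ℂ 8 5) :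
    genericTensorDegreeMonoid (Fin 8) ℂ =
      {d | d = 0 ∨ ∃ δ : ℕ, d = 8 * δ ∧ genericTensorMinimalDegree (Fin 8) ℂ ≤ 8 * δ} := by
  refine genericTensorDegreeMonoid_shape_of_atoms (δ₀ := 3) (by norm_num)
    (BI2017_ex_5_6_eight.trans (by norm_num))
    (kronRect_pos_of_window (by norm_num) (by norm_num) fun δ h1 h2 => ?_)
    (fun δ hδ hlt => ?_)
  · interval_cases δ
    · exact kronRect_eight_three_pos
    · exact h4
    · exact h5
  · interval_cases δ
    · exact kronRect_eq_zero_of_sq_lt ℂ one_pos (by norm_num)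
    · exact kronRect_eq_zero_of_sq_lt ℂ two_pos (by norm_num)

/-- **Ex. 5.6 shape at `m = 9` from atoms**: `E(9) = {0} ∪ (27 + 9ℕ)` ("`E'(9) = {0,3,4,5,6,…}`")
follows from `k_9(5) > 0` (`k_9(3) = 1`, `k_9(4) = 14` are tree theorems).
[cite: BurgisserIkenmeyer2017, Ex. 5.6] -/
theorem BI2017_ex_5_6_shape_nine_of (h5 : 0 < kronRect ℂ 9 5) :
    genericTensorDegreeMonoid (Fin 9) ℂ =
      {d | d = 0 ∨ ∃ δ : ℕ, d = 9 * δ ∧ genericTensorMinimalDegree (Fin 9) ℂ ≤ 9 * δ} := by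
  refine genericTensorDegreeMonoid_shape_of_atoms (δ₀ := 3) (by norm_num)
    (BI2017_ex_5_6_nine.trans (by norm_num))
    (kronRect_pos_of_window (by norm_num) (by norm_num) fun δ h1 h2 => ?_)
    (fun δ hδ hlt => ?_)
  · interval_cases δ
    · simpa using kronRect_sq_pos ℂ 3
    · rw [kronRect_nine_four]; norm_num
    · exact h5
  · interval_cases δ
    · exact kronRect_eq_zero_of_sq_lt ℂ one_pos (by norm_num)
    · exact kronRect_eq_zero_of_sq_lt ℂ two_pos (by norm_num)

/-- **Ex. 5.6 shape at `m = 10` from atoms**: `E(10) = {0} ∪ (40 + 10ℕ)`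
("`E'(10) = {0,4,5,6,7,…}`") follows from `k_10(5), k_10(6), k_10(7) > 0` (`k_10(4) = 13` is a tree
theorem). [cite: BurgisserIkenmeyer2017, Ex. 5.6] -/
theorem BI2017_ex_5_6_shape_ten_of (h5 : 0 < kronRect ℂ 10 5) (h6 : 0 < kronRect ℂ 10 6)
    (h7 : 0 < kronRect ℂ 10 7) :
    genericTensorDegreeMonoid (Fin 10) ℂ =
      {d | d = 0 ∨ ∃ δ : ℕ, d = 10 * δ ∧ genericTensorMinimalDegree (Fin 10) ℂ ≤ 10 * δ} := by
  refine genericTensorDegreeMonoid_shape_of_atoms (δ₀ := 4) (by norm_num)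
    (BI2017_ex_5_6_ten.trans (by norm_num))
    (kronRect_pos_of_window (by norm_num) (by norm_num) fun δ h1 h2 => ?_)
    (fun δ hδ hlt => ?_)
  · interval_cases δ
    · rw [kronRect_ten_four]; norm_num
    · exact h5
    · exact h6
    · exact h7
  · interval_cases δ
    · exact kronRect_eq_zero_of_sq_lt ℂ one_pos (by norm_num)
    · exact kronRect_eq_zero_of_sq_lt ℂ two_pos (by norm_num)
    · exact kronRect_eq_zero_of_sq_lt ℂ three_pos (by norm_num)

/-- **Ex. 5.6 shape at `m = 11` from atoms**: `E(11) = {0} ∪ (44 + 11ℕ)`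
("`E'(11) = {0,4,5,6,7,…}`") follows from `k_11(5), k_11(6), k_11(7) > 0` (`k_11(4) = 6` is a tree
theorem). [cite: BurgisserIkenmeyer2017, Ex. 5.6] -/
theorem BI2017_ex_5_6_shape_eleven_of (h5 : 0 < kronRect ℂ 11 5) (h6 : 0 < kronRect ℂ 11 6)
    (h7 : 0 < kronRect ℂ 11 7) :
    genericTensorDegreeMonoid (Fin 11) ℂ =
      {d | d = 0 ∨ ∃ δ : ℕ, d = 11 * δ ∧ genericTensorMinimalDegree (Fin 11) ℂ ≤ 11 * δ} := by
  refine genericTensorDegreeMonoid_shape_of_atoms (δ₀ := 4) (by norm_num)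
    (BI2017_ex_5_6_eleven.trans (by norm_num))
    (kronRect_pos_of_window (by norm_num) (by norm_num) fun δ h1 h2 => ?_)
    (fun δ hδ hlt => ?_)
  · interval_cases δ
    · rw [kronRect_eleven_four]; norm_num
    · exact h5
    · exact h6
    · exact h7
  · interval_cases δ
    · exact kronRect_eq_zero_of_sq_lt ℂ one_pos (by norm_num)
    · exact kronRect_eq_zero_of_sq_lt ℂ two_pos (by norm_num)
    · exact kronRect_eq_zero_of_sq_lt ℂ three_pos (by norm_num)

/-- **Ex. 5.6 shape at `m = 12` from atoms**: `E(12) = {0} ∪ (48 + 12ℕ)`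
("`E'(12) = {0,4,5,6,7,…}`") follows from `k_12(5), k_12(6), k_12(7) > 0` (`k_12(4) = 5` is a tree
theorem). [cite: BurgisserIkenmeyer2017, Ex. 5.6] -/
theorem BI2017_ex_5_6_shape_twelve_of (h5 : 0 < kronRect ℂ 12 5) (h6 : 0 < kronRect ℂ 12 6)
    (h7 : 0 < kronRect ℂ 12 7) :
    genericTensorDegreeMonoid (Fin 12) ℂ =
      {d | d = 0 ∨ ∃ δ : ℕ, d = 12 * δ ∧ genericTensorMinimalDegree (Fin 12) ℂ ≤ 12 * δ} := by
  refine genericTensorDegreeMonoid_shape_of_atoms (δ₀ := 4) (by norm_num)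
    (BI2017_ex_5_6_twelve.trans (by norm_num))
    (kronRect_pos_of_window (by norm_num) (by norm_num) fun δ h1 h2 => ?_)
    (fun δ hδ hlt => ?_)
  · interval_cases δ
    · rw [kronRect_twelve_four]; norm_num
    · exact h5
    · exact h6
    · exact h7
  · interval_cases δ
    · exact kronRect_eq_zero_of_sq_lt ℂ one_pos (by norm_num)
    · exact kronRect_eq_zero_of_sq_lt ℂ two_pos (by norm_num)
    · exact kronRect_eq_zero_of_sq_lt ℂ three_pos (by norm_num)

/-- **`BI2017_ex_5_6` from its fourteen remaining atoms** — the positivities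
`k_7(5), k_7(6), k_8(4), k_8(5), k_9(5), k_10(5), k_10(6), k_10(7), k_11(5), k_11(6), k_11(7),
k_12(5), k_12(6), k_12(7) > 0` of Ex. 5.6 (DERKSEN computations in print; Kronecker coefficients in
`S_32, …, S_84`); everything else in the named fact is a theorem of the tree
(`BI2017_ex_5_6_of_shape`). Four of the fourteen (`k_8(4), k_10(5), k_10(6), k_12(6)`) reduce to
class sums in `S_16 … S_30` by the mixed-format splitting (`kronRect_pos_of_pieces`,
`kronRect_ten_five_pos_of_kronSum`, `kronRect_ten_six_pos_of_kronSum`); the other ten are coprime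
atoms. [cite: BurgisserIkenmeyer2017, Ex. 5.6 and Rem. 5.18] -/
theorem BI2017_ex_5_6_of_atoms
    (h7_5 : 0 < kronRect ℂ 7 5) (h7_6 : 0 < kronRect ℂ 7 6)
    (h8_4 : 0 < kronRect ℂ 8 4) (h8_5 : 0 < kronRect ℂ 8 5) (h9_5 : 0 < kronRect ℂ 9 5)
    (h10_5 : 0 < kronRect ℂ 10 5) (h10_6 : 0 < kronRect ℂ 10 6) (h10_7 : 0 < kronRect ℂ 10 7)
    (h11_5 : 0 < kronRect ℂ 11 5) (h11_6 : 0 < kronRect ℂ 11 6) (h11_7 : 0 < kronRect ℂ 11 7)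
    (h12_5 : 0 < kronRect ℂ 12 5) (h12_6 : 0 < kronRect ℂ 12 6) (h12_7 : 0 < kronRect ℂ 12 7) :
    BI2017_ex_5_6 := by
  refine BI2017_ex_5_6_of_shape fun m h7 h12 => ?_
  interval_cases m
  · exact BI2017_ex_5_6_shape_seven_of h7_5 h7_6
  · exact BI2017_ex_5_6_shape_eight_of h8_4 h8_5
  · exact BI2017_ex_5_6_shape_nine_of h9_5
  · exact BI2017_ex_5_6_shape_ten_of h10_5 h10_6 h10_7
  · exact BI2017_ex_5_6_shape_eleven_of h11_5 h11_6 h11_7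
  · exact BI2017_ex_5_6_shape_twelve_of h12_5 h12_6 h12_7

end Shape

end Literature.Computability.AlgebraicComplexity
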